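import Summits.AtomisticToContinuum.Crystallization.Theorems.HullExactificationCascadeRobustBarlowTemplateInjectiveCellsB
import Summits.AtomisticToContinuum.Crystallization.Theorems.HullExactificationCascadeRobustBarlowTemplateInjectiveCellwiseApprox
import Summits.AtomisticToContinuum.Crystallization.Theorems.HullExactificationCascadeRobustBarlowTemplateTransportDefs
import Mathlib.Analysis.Normed.Module.Convex
import Mathlib.Topology.MetricSpace.Basic

/-!
# `injective_starApprox` — the STAR ESTIMATE (line `registered`, crux `RobustBarlowTemplate`, stmt-AtomisticToContinuum-12088)

The registered sub-goal `injective_starApprox` of the stub `develop_injective`: for a shell covering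
`Ψ` of a `δ`-separated `S` by the ideal stacking with `LocSim s Ψ`, the piecewise-affine extension
`F = plExtend s (Ψ ∘ siteAt s)` is, on every ball of radius `1/6`, `(27/40) l`-approximately the
similarity `l • A` of `LocSim` at a STAR CENTRE `v` (a site whose closed star contains the ball),
and `20 δ ≤ 21 l`.

## Proof
* `injective_plData_weights` — the point-location weights are non-negative and sum to `1`;
* `injective_starSite` — THE STAR LEMMA: for every `x` there is a site `t₀` (a vertex of maximal
  weight `≥ 1/4` of the cell through `x`) whose hat function `φ = plExtend s 𝟙_{t₀}` does not vanish
  on `ball x (1/6)`: `φ x ≥ 1/4` and `φ` is `√2`-Lipschitz (cell packages + `injective_cellwiseApprox`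
  applied to `φ • e₀`), `√2 / 6 < 1/4`;
* `injective_delta_bound` — `20 δ ≤ 21 l`: an in-layer contact `q` of `v` is mapped into the shell of
  `Ψ v` (star clause of the covering), so `δ ≤ dist (Ψ q) (Ψ v) ≤ l/20 + l`;
* `injective_starApprox` — assembly: the finite cell cover of `closedBall x (1/6)`
  (`injective_cover`), the star-estimate clause of each cell package at the vertex `t₀` detected by
  `φ ≠ 0`, globalised over the ball by `injective_cellwiseApprox`.
-/

noncomputable section

namespace Summit.AtomisticToContinuum.Crystallization.Theorems.HullExactificationCascadeRobustBarlowTemplate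

open Literature.MathematicalPhysics.StatisticalMechanics
open Summit.AtomisticToContinuum.Crystallization.Theorems.PalmUnimodularRigidityShellsToBarlowChart
  (contacts)

/-- Euclidean `3`-space. -/
local notation "E3" => EuclideanSpace ℝ (Fin 3)

/-- The point-location weights are non-negative and sum to `1` (barycentric coordinates of the
located cell). -/
theorem injective_plData_weights {s : ℤ → ℤ} (hs : IsHaggSeq s) (x : E3) :
    (∀ m, 0 ≤ (plData s x).2 m) ∧ ∑ m, (plData s x).2 m = 1 := by
  set k : ℤ := slabOf x with hk
  set c : Fin 3 → ℝ := toSkew s k x with hc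
  have hθ : c 2 = x 2 / hB - k := honeycomb_toSkew_apply_two s k x
  have hk0 : (k : ℝ) ≤ x 2 / hB := Int.floor_le _
  have hk1 : x 2 / hB < k + 1 := Int.lt_floor_add_one _
  have h0 : 0 ≤ c 2 := by rw [hθ]; linarith
  have h1 : c 2 < 1 := by rw [hθ]; linarith
  have e : plData s x = plData s (ofSkew s k c) := by rw [hc, honeycomb_ofSkew_toSkew s k (hs k) x]
  rw [e, honeycomb_plData_ofSkew (hs k) c h0 h1]
  have a0 := Int.floor_le (c 0)
  have a1 := Int.lt_floor_add_one (c 0)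
  have b0 := Int.floor_le (c 1)
  have b1 := Int.lt_floor_add_one (c 1)
  have f0 := Int.self_sub_floor (c 0)
  have f1 := Int.self_sub_floor (c 1)
  simp only []
  split_ifs <;>
    exact ⟨fun m => by fin_cases m <;> simp <;> linarith,
      by simp only [Fin.sum_univ_four, Matrix.cons_val_zero, Matrix.cons_val_one, Matrix.cons_val]; ring⟩

/-- THE STAR LEMMA: for every point `x` there is a site `t₀` whose hat function does not vanish on
the ball of radius `1/6` about `x` (so `t₀` is a vertex of every closed cell meeting that ball). -/
theorem injective_starSite {s : ℤ → ℤ} (hs : IsHaggSeq s) (x : E3) :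
    ∃ t₀ : ℤ × ℤ × ℤ, ∀ y : E3, dist y x < 1 / 6 →
      plExtend s (fun t => if t = t₀ then (1 : ℝ) else 0) y ≠ 0 := by
  obtain ⟨hnn, hsum⟩ := injective_plData_weights hs x
  -- a vertex of the located cell of `x` with weight `≥ 1/4`
  obtain ⟨m₀, hm₀⟩ : ∃ m, 1 / 4 ≤ (plData s x).2 m := by
    by_contra h
    push Not at h
    have hlt : ∑ m, (plData s x).2 m < ∑ _m : Fin 4, (1 / 4 : ℝ) :=
      Finset.sum_lt_sum_of_nonempty Finset.univ_nonempty fun m _ => h m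
    simp at hlt
    linarith
  refine ⟨(plData s x).1 m₀, fun y hy => ?_⟩
  set t₀ := (plData s x).1 m₀ with ht₀
  set φ : E3 → ℝ := plExtend s (fun t => if t = t₀ then (1 : ℝ) else 0) with hφ
  -- `φ x ≥ 1/4`
  have hx : 1 / 4 ≤ φ x := by
    have h1 : (plData s x).2 m₀ • (if (plData s x).1 m₀ = t₀ then (1 : ℝ) else 0) ≤ φ x := by
      simp only [hφ, plExtend]
      exact Finset.single_le_sum
        (f := fun m => (plData s x).2 m • (if (plData s x).1 m = t₀ then (1 : ℝ) else 0))
        (fun m _ => smul_nonneg (hnn m) (by positivity)) (Finset.mem_univ m₀)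
    simp [ht₀] at h1
    linarith
  -- `φ` is `√2`-Lipschitz on the ball
  obtain ⟨𝒞, hfin, hcov, hgood⟩ :=
    injective_cover hs (Metric.closedBall x (1 / 6)) (isCompact_closedBall _ _)
  have hcont : Continuous φ := honeycomb_plExtend_continuous_of hs _
  set e₀ : E3 := EuclideanSpace.single 0 1 with he
  have he₀ : ‖e₀‖ = 1 := by simp [he]
  have key := injective_cellwiseApprox (fun z => φ z • e₀) 0 (Real.sqrt 2) (Metric.ball x (1 / 6)) 𝒞
    (Real.sqrt_nonneg _) (convex_ball _ _) hfin (fun C hC => ⟨(hgood C hC).2.1, (hgood C hC).1⟩)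
    (Metric.ball_subset_closedBall.trans hcov) (hcont.smul continuous_const).continuousOn ?_ y hy
    x (Metric.mem_ball_self (by norm_num))
  · simp only [zero_apply, sub_zero, ← sub_smul, norm_smul, he₀,
      mul_one, Real.norm_eq_abs] at key
    intro h0
    have hΔ : |φ y - φ x| * |φ y - φ x| ≤ (Real.sqrt 2 * ‖y - x‖) * (Real.sqrt 2 * ‖y - x‖) :=
      mul_le_mul key key (abs_nonneg _) (by positivity)
    have h2 : Real.sqrt 2 * ‖y - x‖ * (Real.sqrt 2 * ‖y - x‖) = 2 * (‖y - x‖ * ‖y - x‖) := by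
      rw [mul_mul_mul_comm, Real.mul_self_sqrt (by norm_num)]
    rw [abs_mul_abs_self, h2] at hΔ
    have hφy : φ y = 0 := h0
    rw [hφy] at hΔ
    have hd : ‖y - x‖ < 1 / 6 := by rwa [← dist_eq_norm]
    nlinarith [norm_nonneg (y - x)]
  · intro C hC z hz z' hz'
    simp only [zero_apply, sub_zero, ← sub_smul, norm_smul, he₀,
      mul_one, Real.norm_eq_abs]
    exact (hgood C hC).2.2.1 t₀ z hz.1 z' hz'.1

/-- `20 δ ≤ 21 l` for the `LocSim` scale `l` at any site `v` of a shell covering of a `δ`-separated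
set: an in-layer contact `q` of `v` is mapped into the shell of `Ψ v`, so
`δ ≤ dist (Ψ q) (Ψ v) ≤ l/20 + l`. -/
theorem injective_delta_bound {δ : ℝ} {S : Set E3} {s : ℤ → ℤ} {Ψ : E3 → E3} (hSep : Sep δ S)
    (hcov : IsShellCovering S s Ψ) (t₀ : ℤ × ℤ × ℤ) (A : E3 →ₗᵢ[ℝ] E3) (l : ℝ) (hl : 0 < l)
    (hcl : ∀ q ∈ idealStacking s, dist q (siteAt s t₀) ≤ 1 →
      dist (Ψ q) (Ψ (siteAt s t₀) + l • A (q - siteAt s t₀)) ≤ 1 / 20 * l) :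
    20 * δ ≤ 21 * l := by
  obtain ⟨k, i, j⟩ := t₀
  have hv : siteAt s (k, i, j) ∈ idealStacking s := injective_site_mem s _
  have hqv : dist (siteAt s (k, i + 1, j)) (siteAt s (k, i, j)) = 1 := by
    refine (pow_eq_one_iff_of_nonneg dist_nonneg two_ne_zero).1 ?_
    simp only [siteAt]
    rw [dist_barlowPos_sq]
    push_cast
    ring
  have hq : siteAt s (k, i + 1, j) ∈ contacts s (siteAt s (k, i, j)) :=
    ⟨injective_site_mem s _, by rw [dist_comm]; exact hqv⟩
  have hsh := (hcov.2.1 _ hv).mapsTo hq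
  have hvS : Ψ (siteAt s (k, i, j)) ∈ S := hcov.1 hv
  have hδ : δ ≤ dist (Ψ (siteAt s (k, i + 1, j))) (Ψ (siteAt s (k, i, j))) :=
    hSep _ hsh.1 _ hvS hsh.2.1
  have h1 := hcl _ (injective_site_mem s _) hqv.le
  have hn : ‖l • A (siteAt s (k, i + 1, j) - siteAt s (k, i, j))‖ = l := by
    rw [norm_smul, LinearIsometry.norm_map, ← dist_eq_norm, hqv, Real.norm_eq_abs, abs_of_pos hl,
      mul_one]
  have h2 := dist_triangle (Ψ (siteAt s (k, i + 1, j)))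
    (Ψ (siteAt s (k, i, j)) + l • A (siteAt s (k, i + 1, j) - siteAt s (k, i, j))) (Ψ (siteAt s (k, i, j)))
  rw [dist_eq_norm (Ψ (siteAt s (k, i, j)) + _), add_sub_cancel_left, hn] at h2
  linarith

/-- SUB-GOAL `injective_starApprox` (registered; toward `develop_injective`): THE STAR ESTIMATE — on
every ball of radius `1/6` the piecewise-affine extension of a shell covering with `LocSim` is
`(27/40) l`-approximately the similarity `l • A` of a star centre `v ∈ idealStacking s`, and
`20 δ ≤ 21 l`. -/
theorem injective_starApprox : ∀ (δ : ℝ), 0 < δ → ∀ (S : Set E3) (s : ℤ → ℤ) (Ψ : E3 → E3), Sep δ S → IsHaggSeq s → IsShellCovering S s Ψ → LocSim s Ψ → ∀ x : E3, ∃ (v : E3) (A : E3 →ₗᵢ[ℝ] E3) (l : ℝ), v ∈ idealStacking s ∧ 20 * δ ≤ 21 * l ∧ ∀ y ∈ Metric.ball x (1 / 6), ∀ y' ∈ Metric.ball x (1 / 6), ‖plExtend s (fun t => Ψ (siteAt s t)) y - plExtend s (fun t => Ψ (siteAt s t)) y' - l • A (y - y')‖ ≤ 27 / 40 * l * ‖y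 - y'‖ := by
  intro δ _hδ S s Ψ hSep hs hcov hL x
  obtain ⟨t₀, ht₀⟩ := injective_starSite hs x
  obtain ⟨A, l, hl, hcl⟩ := hL (siteAt s t₀) (injective_site_mem s t₀)
  obtain ⟨𝒞, hfin, hcover, hgood⟩ :=
    injective_cover hs (Metric.closedBall x (1 / 6)) (isCompact_closedBall _ _)
  refine ⟨siteAt s t₀, A, l, injective_site_mem s t₀, injective_delta_bound hSep hcov t₀ A l hl hcl, ?_⟩
  intro y hy y' hy'
  have hF : Continuous (plExtend s (fun t => Ψ (siteAt s t))) := honeycomb_plExtend_continuous s hs _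
  have key := injective_cellwiseApprox (plExtend s (fun t => Ψ (siteAt s t)))
    (l • A.toContinuousLinearMap) (27 / 40 * l) (Metric.ball x (1 / 6)) 𝒞 (by positivity)
    (convex_ball _ _) hfin (fun C hC => ⟨(hgood C hC).2.1, (hgood C hC).1⟩)
    (Metric.ball_subset_closedBall.trans hcover) hF.continuousOn ?_ y hy y' hy'
  · simpa using key
  · intro C hC z hz z' hz'
    have h := (hgood C hC).2.2.2 Ψ hL t₀ A l hl hcl ⟨z, hz.1, ht₀ z hz.2⟩ z hz.1 z' hz'.1
    simpa using h

end Summit.AtomisticToContinuum.Crystallization.Theorems.HullExactificationCascadeRobustBarlowTemplate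

end
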